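import Mathlib
import Summits.Ventures.HodgeRepro.Tier4.Common.AdelicRTF
import Summits.Ventures.HodgeRepro.Tier4.Common.LocalTorus
import Summits.Ventures.HodgeRepro.Tier4.Common.TestProjector
import Summits.Ventures.HodgeRepro.Tier4.Line1.FiniteLevelIsolation
import Summits.Ventures.HodgeRepro.Tier4.Line1.LocallyCompactGA
import Summits.Ventures.HodgeRepro.Tier4.Line1.SecondCountableGA
import Summits.Ventures.HodgeRepro.Tier4.Line4.FinitePlacePositivity
import Summits.Ventures.HodgeRepro.Tier4.Line4.StabilityOfProjected
import Summits.Ventures.HodgeRepro.Tier4.Line4.ProjectedSupport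
import Summits.Ventures.HodgeRepro.Tier4.Line1.RTFSetting
import Summits.Ventures.HodgeRepro.Tier4.Line4.TorusProduct
import Summits.Ventures.HodgeRepro.Tier4.Line4.GASplit
import Summits.Ventures.HodgeRepro.Tier4.Line4.ConvProduct

/-!
# Tier4/Line4/ProjProduct — C-L4-PROJPROD: the `(τ′,K)`-projection of a product test function is a product function

Blind re-derivation cell `pub-hodge-repro`, Tier 4 «prove the step» (README §9–§10), seat t4-L4-p2 (prover, LINE L4,
gen 3; plan-4 g3's product-test-function bookkeeping S14443, Part C; statements VERBATIM from
proofs/t4-plan-4/work/ProductTest-STATEMENTS.lean 5652414f7ea38ea3 — Part A (GASPLIT, with the PARTS laws) and Part B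
(CONVPROD, `IsProductFn`) are L4-p1's / L2-p1's modules, imported). Tree path
`lean/Summits/Ventures/HodgeRepro/Tier4/Line4/ProjProduct.lean`. Mathlib-level; no literature.

A bi-projector `biProj C ν χ f x = ∫_C conj χ(κ) ∫_C χ(κ′) f((x⁻¹κ)⁻¹κ′)` along a subgroup `C ≤ G_∞` acts on the
archimedean factor of a product function `f = f_∞(g_∞) f_f(g_f)` (the finite factor is a constant of both integrals,
pulled out by `integral_mul_const`), and along `C ≤ G_f` on the finite factor (`integral_const_mul`); the
`(τ′,K)`-projector `projTest` is the composite along `placeData ++ [levelDatum]` (`projData_eq`, `biProjList_append`),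
the place data lie in `G_∞` (`localTorusAt'_subset_infinitePart`, L2-p1's ProjectedSupport), the level in `G_f` (`hK`).
The level average of a real non-negative function is real non-negative (`integral_ofReal`, `integral_nonneg`).

Nothing here says anything about the status of the Hodge conjecture for CM abelian varieties, which is NOT proved
(HC_CM is NOT proved by anyone in this repository).
-/

set_option autoImplicit false
noncomputable section
namespace Summit.Ventures.HodgeRepro.Tier4.Line4
open Summit.Ventures.HodgeRepro.Tier4 Summit.Ventures.HodgeRepro.Tier4.Common NumberField
  Summit.Ventures.HodgeRepro.Tier4.Line1 MeasureTheory
open scoped ComplexConjugate Topology Pointwise NNReal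

/-! ## Helpers: `biProj` unfolded, `biProjList` on a concatenation, products through lists of archimedean data -/

section ProjProdHelpers
variable {G : Type} [Group G] [TopologicalSpace G] [IsTopologicalGroup G] [MeasurableSpace G] [BorelSpace G]

omit [TopologicalSpace G] [IsTopologicalGroup G] [BorelSpace G] in
/-- The bi-projector unfolded: `biProj C ν χ f x = ∫_C conj χ(κ) ∫_C χ(κ′) f((x⁻¹κ)⁻¹ κ′)`. -/
theorem biProj_apply (C : Subgroup G) (ν : Measure C) (χ f : G → ℂ) (x : G) :
    biProj C ν χ f x =
      ∫ κ : C, conj (χ κ) * (∫ κ' : C, conj (conj (χ κ')) * f ((x⁻¹ * κ)⁻¹ * κ') ∂ν) ∂ν := rfl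

omit [IsTopologicalGroup G] [BorelSpace G] in
/-- `biProjList` of a concatenation is the composite (by the definition). -/
theorem biProjList_append (l₁ l₂ : List (ProjDatum G)) (f : G → ℂ) :
    biProjList (l₁ ++ l₂) f = biProjList l₁ (biProjList l₂ f) := by
  induction l₁ with
  | nil => rfl
  | cons d l ih => simp only [List.cons_append, biProjList, ih]

end ProjProdHelpers

/-! ## Part C — C-L4-PROJPROD -/

section ProjProd
variable {k : Type} [Field k] [NumberField k] (W : PlaneData k) [MeasurableSpace (GA W)]
  (q : QuadData k) (g g' : Matrix (Fin 4) (Fin 4) k) (eP' eM' : InfinitePlace k → ℤ)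

/-- The archimedean data alone (every infinite place, no level). -/
def placeData (ν : ∀ w : InfinitePlace k, Measure (localTorusAt' W w)) : List (ProjDatum (GA W)) :=
  (Finset.univ : Finset (InfinitePlace k)).toList.map (placeDatum W q g g' eP' eM' ν)

/-- `projData = placeData ++ [levelDatum]` (by definition). -/
theorem projData_eq (ν : ∀ w : InfinitePlace k, Measure (localTorusAt' W w)) (K : Subgroup (GA W)) (νK : Measure K) :
    projData W q g g' eP' eM' ν K νK = placeData W q g g' eP' eM' ν ++ [levelDatum W K νK] := rfl

/-- A bi-projection along a datum whose subgroup lies in `G_∞` acts on the archimedean factor of a product function. -/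
theorem biProj_isProductFn_of_subset_infinitePart (d : ProjDatum (GA W)) (hd : (d.C : Set (GA W)) ⊆ infinitePart W)
    {f finf ffin : GA W → ℂ} (hf : IsProductFn W f finf ffin) :
    IsProductFn W (biProj d.C d.ν d.χ f) (biProj d.C d.ν d.χ finf) ffin := by
  intro x
  have hf' : ∀ y, f y = finf (GA.ofInfPart W y) * ffin (GA.ofFinPart W y) := hf
  have hinf : ∀ κ κ' : d.C, GA.ofInfPart W ((x⁻¹ * (κ : GA W))⁻¹ * (κ' : GA W)) =
      ((GA.ofInfPart W x)⁻¹ * (κ : GA W))⁻¹ * (κ' : GA W) := by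
    intro κ κ'
    rw [ofInfPart_mul, ofInfPart_inv, ofInfPart_mul, ofInfPart_inv,
      ofInfPart_eq_self_of_mem_infinitePart W (hd κ.2), ofInfPart_eq_self_of_mem_infinitePart W (hd κ'.2)]
  have hfin : ∀ κ κ' : d.C, GA.ofFinPart W ((x⁻¹ * (κ : GA W))⁻¹ * (κ' : GA W)) = GA.ofFinPart W x := by
    intro κ κ'
    rw [ofFinPart_mul, ofFinPart_inv, ofFinPart_mul, ofFinPart_inv,
      ofFinPart_eq_one_of_mem_infinitePart W (hd κ.2), ofFinPart_eq_one_of_mem_infinitePart W (hd κ'.2)]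
    simp only [mul_one, inv_inv]
  simp_rw [biProj_apply, hf', hinf, hfin, ← mul_assoc, integral_mul_const, ← mul_assoc, integral_mul_const]

/-- A bi-projection along a datum whose subgroup lies in `G_f` acts on the finite factor of a product function. -/
theorem biProj_isProductFn_of_subset_finitePart (d : ProjDatum (GA W)) (hd : (d.C : Set (GA W)) ⊆ finitePart W)
    {f finf ffin : GA W → ℂ} (hf : IsProductFn W f finf ffin) :
    IsProductFn W (biProj d.C d.ν d.χ f) finf (biProj d.C d.ν d.χ ffin) := by
  intro x
  have hf' : ∀ y, f y = finf (GA.ofInfPart W y) * ffin (GA.ofFinPart W y) := hf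
  have hinf : ∀ κ κ' : d.C, GA.ofInfPart W ((x⁻¹ * (κ : GA W))⁻¹ * (κ' : GA W)) = GA.ofInfPart W x := by
    intro κ κ'
    rw [ofInfPart_mul, ofInfPart_inv, ofInfPart_mul, ofInfPart_inv,
      ofInfPart_eq_one_of_mem_finitePart W (hd κ.2), ofInfPart_eq_one_of_mem_finitePart W (hd κ'.2)]
    simp only [mul_one, inv_inv]
  have hfin : ∀ κ κ' : d.C, GA.ofFinPart W ((x⁻¹ * (κ : GA W))⁻¹ * (κ' : GA W)) =
      ((GA.ofFinPart W x)⁻¹ * (κ : GA W))⁻¹ * (κ' : GA W) := by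
    intro κ κ'
    rw [ofFinPart_mul, ofFinPart_inv, ofFinPart_mul, ofFinPart_inv,
      ofFinPart_eq_self_of_mem_finitePart W (hd κ.2), ofFinPart_eq_self_of_mem_finitePart W (hd κ'.2)]
  simp_rw [biProj_apply, hf', hinf, hfin, mul_left_comm _ (finf (GA.ofInfPart W x)), integral_const_mul,
    mul_left_comm _ (finf (GA.ofInfPart W x)), integral_const_mul]

/-- **C-L4-PROJPROD**: the `(τ′,K)`-projection of a product function is a product function — the archimedean projectors
applied to `f_∞`, the level projector to `f_f` (`localTorusAt'_subset_infinitePart`, `hK`). -/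
theorem isProductFn_projTest (ν : ∀ w : InfinitePlace k, Measure (localTorusAt' W w)) (K : Subgroup (GA W)) (νK : Measure K)
    (hK : (K : Set (GA W)) ⊆ finitePart W) {f finf ffin : GA W → ℂ} (hf : IsProductFn W f finf ffin) :
    IsProductFn W (projTest W q g g' eP' eM' ν K νK f) (biProjList (placeData W q g g' eP' eM' ν) finf)
      (biProj K νK (fun _ => (1 : ℂ)) ffin) := by
  have hlevel : IsProductFn W (biProj K νK (fun _ => (1 : ℂ)) f) finf (biProj K νK (fun _ => (1 : ℂ)) ffin) :=
    biProj_isProductFn_of_subset_finitePart W (levelDatum W K νK) hK hf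
  have hplaces : ∀ l : List (ProjDatum (GA W)), (∀ d ∈ l, (d.C : Set (GA W)) ⊆ infinitePart W) →
      ∀ {f₀ : GA W → ℂ}, IsProductFn W f₀ finf (biProj K νK (fun _ => (1 : ℂ)) ffin) →
        IsProductFn W (biProjList l f₀) (biProjList l finf) (biProj K νK (fun _ => (1 : ℂ)) ffin) := by
    intro l
    induction l with
    | nil => intro _ f₀ h; exact h
    | cons d l ih =>
      intro hl f₀ h
      exact biProj_isProductFn_of_subset_infinitePart W d (hl d (List.mem_cons_self ..))
        (ih (fun d' hd' => hl d' (List.mem_cons_of_mem _ hd')) h)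
  have hsub : ∀ d ∈ placeData W q g g' eP' eM' ν, (d.C : Set (GA W)) ⊆ infinitePart W := by
    intro d hd
    obtain ⟨w, _, rfl⟩ := List.mem_map.1 hd
    exact localTorusAt'_subset_infinitePart W w
  unfold projTest
  rw [projData_eq, biProjList_append]
  exact hplaces _ hsub hlevel

/-- **The level projection of a real non-negative function is real non-negative** (the finite factor FINSUM wants):
`biProj K νK 1 f_f = ∫∫ f_f(κ y κ′)` with `f_f ≥ 0`. -/
theorem biProj_level_nonneg (K : Subgroup (GA W)) (νK : Measure K) {ffin : GA W → ℂ}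
    (hreal : ∀ y, (ffin y).im = 0) (hnonneg : ∀ y, 0 ≤ (ffin y).re) (y : GA W) :
    (biProj K νK (fun _ => (1 : ℂ)) ffin y).im = 0 ∧ 0 ≤ (biProj K νK (fun _ => (1 : ℂ)) ffin y).re := by
  have hffin : ∀ z, ffin z = ((ffin z).re : ℂ) := fun z =>
    Complex.ext (by simp) (by simp [hreal z])
  have hval : biProj K νK (fun _ => (1 : ℂ)) ffin y =
      ((∫ κ : K, ∫ κ' : K, (ffin ((y⁻¹ * κ)⁻¹ * κ')).re ∂νK ∂νK : ℝ) : ℂ) := by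
    rw [biProj_apply]
    have h1 : (starRingEnd ℂ) 1 = 1 := map_one _
    simp only [h1, one_mul]
    have hfun : ffin = fun z => (((ffin z).re : ℝ) : ℂ) := funext hffin
    conv_lhs => rw [hfun]
    simp only [integral_complex_ofReal]
  rw [hval]
  refine ⟨Complex.ofReal_im _, ?_⟩
  rw [Complex.ofReal_re]
  exact integral_nonneg fun κ => integral_nonneg fun κ' => hnonneg _

end ProjProd

end Summit.Ventures.HodgeRepro.Tier4.Line4
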